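import Summits.Ventures.Crystal3D.Theorems.StickyWulffConstantGenericWallFloorSlotGeometry
import Literature.Barriers.AtomisticToContinuum.HcpNotBravais
import HarnessLib

/-!
# The coincidence module of two moved fcc lattices has rank `≤ 1` or `3` (crux `GenericWallFloor`,
# line `WallLedgerG`, planner mechanism (S) «coincidence-coset sparsity»)

HONEST FRAMING. Part of the venture `Summits/Ventures/Crystal3D` (cell `crystal3d-full`), helper
`--supports` the crux `GenericWallFloor` (stmt-Ventures-19480) of `route-Ventures-StickyWulffConstant`,
registered line `WallLedgerG` (planner cf-p1 gen 16), stub `stub_twoSlabAdhesion : TwoSlabAdhesion`.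
Memo HOME/cf-p1/ROUTE.md §68.3 (S): positions in registry with BOTH clamped grains lie in finitely many
cosets of the coincidence module `L = A₁·Λ₀ ∩ A₂·Λ₀`; «rank ≤ 2 ⇒ O((1+h)ρ) per cell; rank 3 = CSL».  The
areal bookkeeping needs rank `2` to be IMPOSSIBLE (a rank-2 coincidence module spanning a near-horizontal
plane would give an areal density of double-registry sites without a CSL structure).  This file proves it:

* `exists_orthogonal_site` — for two sites `x, y ∈ Λ₀` there is a site `z ∈ Λ₀` orthogonal to both
  with `‖z‖² = 8 (‖x‖²‖y‖² − ⟪x,y⟫²)` (twice the cubic-frame cross product: `Λ₀ ≅ D₃/√2` and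
  `2 (X × Y) ∈ 2ℤ³ ⊆ D₃`; Lagrange's identity);
* `eq_or_eq_neg_of_orthogonal_pair` — in `ℝ³` two vectors of equal length orthogonal to an independent
  pair coincide up to sign;
* **`exists_third_coincidence`** — if the linear lattices `A₁·Λ₀`, `A₂·Λ₀` share two vectors `p, q`
  with non-zero Gram determinant, they share a non-zero vector orthogonal to both: the coincidence
  module has rank `3` as soon as it has rank `≥ 2`.

WHAT THIS IS NOT: the index/Σ classification of rank-3 coincidence (CSL) pairs; nothing about walls;
rung F-C1 not moved.
-/

noncomputable section

namespace Summit.Ventures.Crystal3D.Theorems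

open Literature.MathematicalPhysics.StatisticalMechanics
open Literature.Barriers.AtomisticToContinuum (barlowAddSubgroupOfConst)
open scoped InnerProductSpace

/-! ### A lattice vector orthogonal to two lattice vectors (cubic cross product) -/

/-- **Twice the cubic cross product is a site.**  For sites `x, y ∈ Λ₀ = fccStacking 1 √(2/3)` there is
a site `z ∈ Λ₀` with `⟪z, x⟫ = ⟪z, y⟫ = 0` and `‖z‖² = 8 (‖x‖² ‖y‖² − ⟪x, y⟫²)`. -/
theorem exists_orthogonal_site {x y : EuclideanSpace ℝ (Fin 3)}
    (hx : x ∈ fccStacking 1 (Real.sqrt (2 / 3))) (hy : y ∈ fccStacking 1 (Real.sqrt (2 / 3))) :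
    ∃ z ∈ fccStacking 1 (Real.sqrt (2 / 3)), ⟪z, x⟫_ℝ = 0 ∧ ⟪z, y⟫_ℝ = 0 ∧
      ‖z‖ ^ 2 = 8 * (‖x‖ ^ 2 * ‖y‖ ^ 2 - ⟪x, y⟫_ℝ ^ 2) := by
  obtain ⟨k, i, j, rfl⟩ := hx
  obtain ⟨k', i', j', rfl⟩ := hy
  -- cubic coordinates of the two sites
  obtain ⟨xa, xb, xc⟩ := cubic_barlowPos k i j
  obtain ⟨ya, yb, yc⟩ := cubic_barlowPos k' i' j'
  -- the doubled cross product, an even-sum integer triple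
  set X₁ : ℤ := i + j with hX₁
  set X₂ : ℤ := i + k with hX₂
  set X₃ : ℤ := j + k with hX₃
  set Y₁ : ℤ := i' + j' with hY₁
  set Y₂ : ℤ := i' + k' with hY₂
  set Y₃ : ℤ := j' + k' with hY₃
  obtain ⟨k'', i'', j'', e₁, e₂, e₃⟩ := barlowPos_of_cubic (2 * (X₂ * Y₃ - X₃ * Y₂))
    (2 * (X₃ * Y₁ - X₁ * Y₃)) (2 * (X₁ * Y₂ - X₂ * Y₁)) ⟨X₂ * Y₃ - X₃ * Y₂ + (X₃ * Y₁ - X₁ * Y₃) +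
      (X₁ * Y₂ - X₂ * Y₁), by ring⟩
  refine ⟨barlowPos 1 (Real.sqrt (2 / 3)) constHagg k'' i'' j'', barlowPos_mem _ _ _, ?_, ?_, ?_⟩
  all_goals obtain ⟨za, zb, zc⟩ := cubic_barlowPos k'' i'' j''
  · rw [inner_eq_half_cubic, za, zb, zc, xa, xb, xc]
    have e₁' : ((i'' : ℝ) + j'') = 2 * (((i : ℝ) + k) * ((j' : ℝ) + k') - ((j : ℝ) + k) * ((i' : ℝ) + k')) := by
      have := e₁; rw [hX₂, hX₃, hY₂, hY₃] at this; exact_mod_cast this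
    have e₂' : ((i'' : ℝ) + k'') = 2 * (((j : ℝ) + k) * ((i' : ℝ) + j') - ((i : ℝ) + j) * ((j' : ℝ) + k')) := by
      have := e₂; rw [hX₃, hX₁, hY₁, hY₃] at this; exact_mod_cast this
    have e₃' : ((j'' : ℝ) + k'') = 2 * (((i : ℝ) + j) * ((i' : ℝ) + k') - ((i : ℝ) + k) * ((i' : ℝ) + j')) := by
      have := e₃; rw [hX₁, hX₂, hY₂, hY₁] at this; exact_mod_cast this
    rw [e₁', e₂', e₃']; ring
  · rw [inner_eq_half_cubic, za, zb, zc, ya, yb, yc]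
    have e₁' : ((i'' : ℝ) + j'') = 2 * (((i : ℝ) + k) * ((j' : ℝ) + k') - ((j : ℝ) + k) * ((i' : ℝ) + k')) := by
      have := e₁; rw [hX₂, hX₃, hY₂, hY₃] at this; exact_mod_cast this
    have e₂' : ((i'' : ℝ) + k'') = 2 * (((j : ℝ) + k) * ((i' : ℝ) + j') - ((i : ℝ) + j) * ((j' : ℝ) + k')) := by
      have := e₂; rw [hX₃, hX₁, hY₁, hY₃] at this; exact_mod_cast this
    have e₃' : ((j'' : ℝ) + k'') = 2 * (((i : ℝ) + j) * ((i' : ℝ) + k') - ((i : ℝ) + k) * ((i' : ℝ) + j')) := by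
      have := e₃; rw [hX₁, hX₂, hY₂, hY₁] at this; exact_mod_cast this
    rw [e₁', e₂', e₃']; ring
  · have hz := two_mul_norm_sq_eq_cubic (barlowPos 1 (Real.sqrt (2 / 3)) constHagg k'' i'' j'')
    have hxn := two_mul_norm_sq_eq_cubic (barlowPos 1 (Real.sqrt (2 / 3)) constHagg k i j)
    have hyn := two_mul_norm_sq_eq_cubic (barlowPos 1 (Real.sqrt (2 / 3)) constHagg k' i' j')
    have hxy := inner_eq_half_cubic (barlowPos 1 (Real.sqrt (2 / 3)) constHagg k i j)
      (barlowPos 1 (Real.sqrt (2 / 3)) constHagg k' i' j')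
    rw [za, zb, zc] at hz
    rw [xa, xb, xc] at hxn
    rw [ya, yb, yc] at hyn
    rw [xa, xb, xc, ya, yb, yc] at hxy
    have e₁' : ((i'' : ℝ) + j'') = 2 * (((i : ℝ) + k) * ((j' : ℝ) + k') - ((j : ℝ) + k) * ((i' : ℝ) + k')) := by
      have := e₁; rw [hX₂, hX₃, hY₂, hY₃] at this; exact_mod_cast this
    have e₂' : ((i'' : ℝ) + k'') = 2 * (((j : ℝ) + k) * ((i' : ℝ) + j') - ((i : ℝ) + j) * ((j' : ℝ) + k')) := by
      have := e₂; rw [hX₃, hX₁, hY₁, hY₃] at this; exact_mod_cast this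
    have e₃' : ((j'' : ℝ) + k'') = 2 * (((i : ℝ) + j) * ((i' : ℝ) + k') - ((i : ℝ) + k) * ((i' : ℝ) + j')) := by
      have := e₃; rw [hX₁, hX₂, hY₂, hY₁] at this; exact_mod_cast this
    rw [e₁', e₂', e₃'] at hz
    have hz2 : ‖barlowPos 1 (Real.sqrt (2 / 3)) constHagg k'' i'' j''‖ ^ 2 =
        ((2 * (((i : ℝ) + k) * ((j' : ℝ) + k') - ((j : ℝ) + k) * ((i' : ℝ) + k'))) ^ 2 +
          (2 * (((j : ℝ) + k) * ((i' : ℝ) + j') - ((i : ℝ) + j) * ((j' : ℝ) + k'))) ^ 2 +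
          (2 * (((i : ℝ) + j) * ((i' : ℝ) + k') - ((i : ℝ) + k) * ((i' : ℝ) + j'))) ^ 2) / 2 := by
      linarith
    have hx2 : ‖barlowPos 1 (Real.sqrt (2 / 3)) constHagg k i j‖ ^ 2 =
        (((i : ℝ) + j) * ((i : ℝ) + j) + ((i : ℝ) + k) * ((i : ℝ) + k) + ((j : ℝ) + k) * ((j : ℝ) + k)) / 2 := by
      linarith
    have hy2 : ‖barlowPos 1 (Real.sqrt (2 / 3)) constHagg k' i' j'‖ ^ 2 =
        (((i' : ℝ) + j') * ((i' : ℝ) + j') + ((i' : ℝ) + k') * ((i' : ℝ) + k') +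
          ((j' : ℝ) + k') * ((j' : ℝ) + k')) / 2 := by
      linarith
    rw [hxy, hz2, hx2, hy2]
    ring

/-! ### Rank: two independent coincidences force a third -/

/-- **Equal-length vectors orthogonal to an independent pair agree up to sign** (the orthogonal
complement of a plane in `ℝ³` is a line).  Independence of `p, q` is expressed by the Gram
determinant `‖p‖²‖q‖² − ⟪p,q⟫² ≠ 0`. -/
theorem eq_or_eq_neg_of_orthogonal_pair (p q r₁ r₂ : EuclideanSpace ℝ (Fin 3))
    (hG : ‖p‖ ^ 2 * ‖q‖ ^ 2 - ⟪p, q⟫_ℝ ^ 2 ≠ 0) (hr₁ : r₁ ≠ 0)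
    (h1p : ⟪r₁, p⟫_ℝ = 0) (h1q : ⟪r₁, q⟫_ℝ = 0) (h2p : ⟪r₂, p⟫_ℝ = 0) (h2q : ⟪r₂, q⟫_ℝ = 0)
    (hn : ‖r₁‖ = ‖r₂‖) : r₂ = r₁ ∨ r₂ = -r₁ := by
  have hpp : ⟪p, p⟫_ℝ = ‖p‖ ^ 2 := real_inner_self_eq_norm_sq p
  have hqq : ⟪q, q⟫_ℝ = ‖q‖ ^ 2 := real_inner_self_eq_norm_sq q
  have hrr : ⟪r₁, r₁⟫_ℝ = ‖r₁‖ ^ 2 := real_inner_self_eq_norm_sq r₁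
  have hqp : ⟪q, p⟫_ℝ = ⟪p, q⟫_ℝ := real_inner_comm _ _
  have hp1 : ⟪p, r₁⟫_ℝ = 0 := by rw [real_inner_comm]; exact h1p
  have hq1 : ⟪q, r₁⟫_ℝ = 0 := by rw [real_inner_comm]; exact h1q
  have hr0 : ‖r₁‖ ^ 2 ≠ 0 := by positivity
  -- Gram elimination: `a P + b R = 0`, `a R + b Q = 0` ⇒ `a = b = 0`
  have gram : ∀ a b : ℝ, a * ‖p‖ ^ 2 + b * ⟪p, q⟫_ℝ = 0 → a * ⟪p, q⟫_ℝ + b * ‖q‖ ^ 2 = 0 →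
      a = 0 ∧ b = 0 := by
    intro a b e1 e2
    have ha : a * (‖p‖ ^ 2 * ‖q‖ ^ 2 - ⟪p, q⟫_ℝ ^ 2) = 0 := by
      linear_combination ‖q‖ ^ 2 * e1 - ⟪p, q⟫_ℝ * e2
    have hb : b * (‖p‖ ^ 2 * ‖q‖ ^ 2 - ⟪p, q⟫_ℝ ^ 2) = 0 := by
      linear_combination ‖p‖ ^ 2 * e2 - ⟪p, q⟫_ℝ * e1
    exact ⟨(mul_eq_zero.1 ha).resolve_right hG, (mul_eq_zero.1 hb).resolve_right hG⟩
  -- `p, q, r₁` are linearly independent, hence span `ℝ³`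
  have hli : LinearIndependent ℝ ![p, q, r₁] := by
    rw [Fintype.linearIndependent_iff]
    intro g hg
    simp only [Fin.sum_univ_three, Matrix.cons_val_zero, Matrix.cons_val_one, Matrix.cons_val] at hg
    have e1 := congrArg (fun v => ⟪v, p⟫_ℝ) hg
    have e2 := congrArg (fun v => ⟪v, q⟫_ℝ) hg
    have e3 := congrArg (fun v => ⟪v, r₁⟫_ℝ) hg
    simp only [inner_add_left, real_inner_smul_left, inner_zero_left, hpp, hqp, h1p, hqq, h1q, hp1, hq1,
      hrr, mul_zero, add_zero, zero_add] at e1 e2 e3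
    obtain ⟨g0, g1⟩ := gram (g 0) (g 1) e1 e2
    have g2 : g 2 = 0 := (mul_eq_zero.1 e3).resolve_right hr0
    intro i
    fin_cases i
    exacts [g0, g1, g2]
  have hspan := hli.span_eq_top_of_card_eq_finrank' (by simp)
  have hr₂ : r₂ ∈ Submodule.span ℝ (Set.range ![p, q, r₁]) := by rw [hspan]; exact Submodule.mem_top
  obtain ⟨c, hc⟩ := (Submodule.mem_span_range_iff_exists_fun ℝ).1 hr₂
  simp only [Fin.sum_univ_three, Matrix.cons_val_zero, Matrix.cons_val_one, Matrix.cons_val] at hc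
  have e1 := congrArg (fun v => ⟪v, p⟫_ℝ) hc
  have e2 := congrArg (fun v => ⟪v, q⟫_ℝ) hc
  simp only [inner_add_left, real_inner_smul_left, hpp, hqp, h1p, hqq, h1q, h2p, h2q, mul_zero,
    add_zero] at e1 e2
  obtain ⟨c0, c1⟩ := gram (c 0) (c 1) e1 e2
  rw [c0, c1, zero_smul, zero_smul, zero_add, zero_add] at hc
  -- `r₂ = c₂ • r₁` with `|c₂| = 1`
  have hc2 : c 2 ^ 2 = 1 := by
    have := congrArg (fun v => ‖v‖ ^ 2) hc
    simp only [norm_smul, mul_pow, Real.norm_eq_abs, sq_abs] at this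
    rw [← hn] at this
    have h' : (c 2 ^ 2 - 1) * ‖r₁‖ ^ 2 = 0 := by linarith
    have := (mul_eq_zero.1 h').resolve_right hr0
    linarith
  have : (c 2 - 1) * (c 2 + 1) = 0 := by ring_nf; linarith
  rcases mul_eq_zero.1 this with h | h
  · left; rw [← hc, show c 2 = 1 by linarith, one_smul]
  · right; rw [← hc, show c 2 = -1 by linarith, neg_one_smul]

/-- **The coincidence module has rank `3` as soon as it has rank `2`.**  If the linear lattices
`A₁·Λ₀` and `A₂·Λ₀` share two vectors `p, q` with non-zero Gram determinant, they share a non-zero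
vector orthogonal to both (twice the cross product taken inside either lattice — both candidates have
the same length and are orthogonal to `p, q`, so they agree up to sign). -/
theorem exists_third_coincidence (A₁ A₂ : EuclideanSpace ℝ (Fin 3) ≃ₗᵢ[ℝ] EuclideanSpace ℝ (Fin 3))
    (p q : EuclideanSpace ℝ (Fin 3))
    (hp₁ : p ∈ A₁ '' fccStacking 1 (Real.sqrt (2 / 3))) (hq₁ : q ∈ A₁ '' fccStacking 1 (Real.sqrt (2 / 3)))
    (hp₂ : p ∈ A₂ '' fccStacking 1 (Real.sqrt (2 / 3))) (hq₂ : q ∈ A₂ '' fccStacking 1 (Real.sqrt (2 / 3)))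
    (hG : ‖p‖ ^ 2 * ‖q‖ ^ 2 - ⟪p, q⟫_ℝ ^ 2 ≠ 0) :
    ∃ r : EuclideanSpace ℝ (Fin 3), r ∈ A₁ '' fccStacking 1 (Real.sqrt (2 / 3)) ∧
      r ∈ A₂ '' fccStacking 1 (Real.sqrt (2 / 3)) ∧ r ≠ 0 ∧ ⟪r, p⟫_ℝ = 0 ∧ ⟪r, q⟫_ℝ = 0 := by
  -- the candidate in each lattice
  have cand : ∀ A : EuclideanSpace ℝ (Fin 3) ≃ₗᵢ[ℝ] EuclideanSpace ℝ (Fin 3),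
      p ∈ A '' fccStacking 1 (Real.sqrt (2 / 3)) → q ∈ A '' fccStacking 1 (Real.sqrt (2 / 3)) →
      ∃ r ∈ A '' fccStacking 1 (Real.sqrt (2 / 3)), -r ∈ A '' fccStacking 1 (Real.sqrt (2 / 3)) ∧
        ⟪r, p⟫_ℝ = 0 ∧ ⟪r, q⟫_ℝ = 0 ∧ ‖r‖ ^ 2 = 8 * (‖p‖ ^ 2 * ‖q‖ ^ 2 - ⟪p, q⟫_ℝ ^ 2) := by
    rintro A ⟨x, hx, rfl⟩ ⟨y, hy, rfl⟩
    obtain ⟨z, hz, hzx, hzy, hzn⟩ := exists_orthogonal_site hx hy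
    set G₁ : AddSubgroup (EuclideanSpace ℝ (Fin 3)) :=
      barlowAddSubgroupOfConst 1 (Real.sqrt (2 / 3)) constHagg (fun _ => rfl) with hG₁
    have hG₁mem : ∀ w, w ∈ G₁ ↔ w ∈ fccStacking 1 (Real.sqrt (2 / 3)) := fun w => Iff.rfl
    refine ⟨A z, ⟨z, hz, rfl⟩, ⟨-z, (hG₁mem _).1 (G₁.neg_mem ((hG₁mem _).2 hz)), by simp⟩, ?_, ?_, ?_⟩
    · rw [LinearIsometryEquiv.inner_map_map, hzx]
    · rw [LinearIsometryEquiv.inner_map_map, hzy]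
    · rw [LinearIsometryEquiv.norm_map, hzn, LinearIsometryEquiv.norm_map, LinearIsometryEquiv.norm_map,
        LinearIsometryEquiv.inner_map_map]
  obtain ⟨r₁, hr₁, -, h1p, h1q, h1n⟩ := cand A₁ hp₁ hq₁
  obtain ⟨r₂, hr₂, hr₂neg, h2p, h2q, h2n⟩ := cand A₂ hp₂ hq₂
  have hr₁0 : r₁ ≠ 0 := by
    intro h
    rw [h, norm_zero] at h1n
    apply hG
    linarith
  have hn : ‖r₁‖ = ‖r₂‖ := by
    have h := (sq_eq_sq₀ (norm_nonneg r₁) (norm_nonneg r₂)).1 (by rw [h1n, h2n])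
    exact h
  refine ⟨r₁, hr₁, ?_, hr₁0, h1p, h1q⟩
  rcases eq_or_eq_neg_of_orthogonal_pair p q r₁ r₂ hG hr₁0 h1p h1q h2p h2q hn with h | h
  · rw [← h]; exact hr₂
  · rw [show r₁ = -r₂ by rw [h, neg_neg]]; exact hr₂neg

end Summit.Ventures.Crystal3D.Theorems

end
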